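import Literature.IUT.HodgeTheaters.PiAvatarFlStarCharacter

/-!
# [IUTchI] Def 6.1 (v): automorphisms of square in `Π_{X_K}` lie in `Aut_±(𝒟^{⊚±})` — the exponent character of an
# "involution" is `±1` (proof-only; (I2)(i) of the β-engine recipe for the genuine kit)

S. Mochizuki, *Inter-universal Teichmüller theory I*, kurims manuscript (May 2020), §6 Definition 6.1 (v) p. 158:
"this rank one quotient determines a natural surjective homomorphism `Aut(𝒟^{⊚±}) ↠ 𝔽_l^⋇` … whose kernel we
denote by `Aut_±(𝒟^{⊚±})`. One verifies immediately that the subgroup `Aut_±(𝒟^{⊚±}) ⊆ Aut(𝒟^{⊚±}) ⥲ Aut(X̲_K)`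
contains the subgroup `Aut_K(X̲_K)`" — in particular the deck involution of `𝒟^{⊚±} → 𝒟^⊚` (the `±1 ∈ 𝔽_l^{⋊±}`)
lies in `Aut_±` ([IUTchI] Def 6.1 (v) p.158) [claim: Mochizuki2012, status: disputed] (D-0012 claim key, series status
DISPUTED — FINITE GROUP THEORY over abc-iut-w4-d065's `conjExponent` / `toFlStarOfNormalizer` (p423880); nothing of the
series is asserted; no side is taken on [IUTchIII] Cor. 3.12).

WHY (abc-iut-L5-t13 β-engine, p420660 → p421603 → p423891; abc-iut-L5-lead RULINGS #33 (1)): at the genuine kit the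
law (β) `Ex63.NegCompatModel` needs, for the global automorphism `b = (yΠ_{X̲_K} ↦ ycΠ_{X̲_K})`, `c ∈ Π_{C̲_K} ∖ Π_{X̲_K}`
(abc-iut-L5-t4 p421129/p422024), the membership `b ∈ Aut_±(𝒟^{⊚±})`, i.e. `toFlStar b = 1` (criterion
`Ex63.mem_lifts_zero_negOne_of_fixes`, p423891).  With `toFlStar` read through abc-iut-w4-d065's `toFlStarOfNormalizer`
(D13-P3-v (L3)) this is AUTOMATIC for every `c` whose SQUARE lies in `X = Π_{X_K}` — no knowledge of HOW `c` acts on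
the rank one quotient `Π_{X_K}/Π_{X̲_K}` is needed (the exponent character is a homomorphism to `(ℤ/l)^×`, `l` prime,
so an element of square in `X` has exponent `u` with `u² = 1`, i.e. `u = ±1 ↦ 1 ∈ 𝔽_l^⋇ = (ℤ/l)^×/{±1}`):

* `conjExponent_eq_one_or_neg_one_of_mul_self_mem` — `n·n ∈ X ⇒ χ(n) = ±1`;
* `toFlStarOfNormalizer_eq_one_of_mul_self_mem` — `n·n ∈ X ⇒ toFlStarOfNormalizer n = 1`;
* `toFlStarOfNormalizer_eq_one_of_mem_of_relIndex_two` — if `n` lies in a subgroup `C` with `[C : Y ∩ C] = 2`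
  (at the instance: `C = Π_{C̲_K}`, `[Π_{C̲_K} : Π_{X̲_K}] = 2`, abc-iut-L5-t4 `piXund_relIndex_piCund`) then
  `toFlStarOfNormalizer n = 1` — every element of `Π_{C̲_K}` (normalising `X` and `Y`) acts on `𝒟^{⊚±}` inside `Aut_±`.

Proof-only (no definitions, no `Prop` facts); typed ≠ proved elsewhere.
-/

namespace Literature.IUT.HodgeTheaters

section Subquotient

variable {A : Type*} [Group A] {Y X : Subgroup A} {l : ℕ} [hp : Fact l.Prime]

/-- In the unit group of the field `ℤ/l` an element of square `1` is `±1`. [folklore] -/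
private theorem units_eq_one_or_eq_neg_one_of_mul_self {u : (ZMod l)ˣ} (h : u * u = 1) : u = 1 ∨ u = -1 := by
  have h' : (u : ZMod l) * u = 1 := by rw [← Units.val_mul, h, Units.val_one]
  rcases mul_self_eq_one_iff.mp h' with h1 | h1
  · exact Or.inl (Units.ext h1)
  · exact Or.inr (Units.ext (by rw [h1, Units.val_neg, Units.val_one]))

/-- **An element of the joint normaliser whose square lies in `X` has exponent `±1` on `X ⧸ Y`** (`l` prime:
`χ(n)² = χ(n²) = 1` in `(ℤ/l)^×`). [IUTchI] Def 6.1 (v) p. 158: the deck involution of `𝒟^{⊚±} → 𝒟^⊚` acts on the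
rank one quotient by `±1`. ([IUTchI] Def 6.1 (v) p.158) [claim: Mochizuki2012, status: disputed] -/
theorem conjExponent_eq_one_or_neg_one_of_mul_self_mem (hYX : Y ≤ X) [(Y.subgroupOf X).Normal]
    (hidx : Y.relIndex X = l) (n : ↥(Subgroup.normalizer (X : Set A) ⊓ Subgroup.normalizer (Y : Set A)))
    (hn : (n : A) * n ∈ X) :
    conjExponent Y X hYX hidx n = 1 ∨ conjExponent Y X hYX hidx n = -1 := by
  apply units_eq_one_or_eq_neg_one_of_mul_self
  rw [← map_mul]
  exact conjExponent_eq_one_of_mem hYX hidx (n * n) hn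

/-- **Hence such an element lies in `Aut_±`**: `toFlStarOfNormalizer n = 1` whenever `n·n ∈ X` ([IUTchI] Def 6.1 (v)
p. 158: "`Aut_±(𝒟^{⊚±}) … contains the subgroup `Aut_K(X̲_K)`", at the `±`-involution; no hypothesis on HOW `n` acts
on `X ⧸ Y`). ([IUTchI] Def 6.1 (v) p.158) [claim: Mochizuki2012, status: disputed] -/
theorem toFlStarOfNormalizer_eq_one_of_mul_self_mem (hYX : Y ≤ X) [(Y.subgroupOf X).Normal]
    (hidx : Y.relIndex X = l) (n : ↥(Subgroup.normalizer (X : Set A) ⊓ Subgroup.normalizer (Y : Set A)))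
    (hn : (n : A) * n ∈ X) : toFlStarOfNormalizer Y X hYX hidx n = 1 :=
  (toFlStarOfNormalizer_eq_one_iff hYX hidx n).mpr (conjExponent_eq_one_or_neg_one_of_mul_self_mem hYX hidx n hn)

/-- **The index-two overgroup lies in `Aut_±`**: if `n` belongs to a subgroup `C` in which `Y` has relative index two
(at the genuine data `C = Π_{C̲_K}`, `Y = Π_{X̲_K}`, abc-iut-L5-t4 `InitialThetaData.piXund_relIndex_piCund`; `X = Π_{X_K}`),
then `n·n ∈ Y ≤ X` and `toFlStarOfNormalizer n = 1` — the deck involution of `𝒟^{⊚±} → 𝒟^⊚` (any `n ∈ Π_{C̲_K} ∖ Π_{X̲_K}`)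
is a `±`-automorphism ([IUTchI] Def 6.1 (v) p.158). ([IUTchI] Def 6.1 (v) p.158) [claim: Mochizuki2012, status: disputed] -/
theorem toFlStarOfNormalizer_eq_one_of_mem_of_relIndex_two (hYX : Y ≤ X) [(Y.subgroupOf X).Normal]
    (hidx : Y.relIndex X = l) {C : Subgroup A} (h2 : Y.relIndex C = 2)
    (n : ↥(Subgroup.normalizer (X : Set A) ⊓ Subgroup.normalizer (Y : Set A))) (hnC : (n : A) ∈ C) :
    toFlStarOfNormalizer Y X hYX hidx n = 1 := by
  apply toFlStarOfNormalizer_eq_one_of_mul_self_mem hYX hidx n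
  have key := (Subgroup.mul_mem_iff_of_index_two h2 (a := ⟨(n : A), hnC⟩) (b := ⟨(n : A), hnC⟩)).2 Iff.rfl
  have hY : (n : A) * n ∈ Y := by
    have := Subgroup.mem_subgroupOf.mp key
    simpa using this
  exact hYX hY

end Subquotient

end Literature.IUT.HodgeTheaters
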